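import Summits.Ventures.PackingBounds.Configurations.GramIsometry

/-!
# Energy rigidity and uniqueness for the regular simplices: ground states of `(1+t)^k`, `k ≥ 2`

Framing: lottery ticket; floor = certified bounds/negative ranges. Venture `PackingBounds` (cell
`pub-packcert`, seat `pub-packcert-energy`) — Cohn–Kumar Table 1, the simplex rows, uniqueness column.

For `N ≥ 2` unit vectors the tangent line of `u ↦ u^k` at `u₀ = 1 - 1/(N-1)` gives
`Σ_{x ≠ y} (1+⟪x,y⟫)^k ≥ N(N-1) u₀^k + k u₀^{k-1} ‖Σ x‖²` (`ckPow_energy_ge_tangent`), and the tangent inequality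
is strict off `u₀` for `k ≥ 2` (`pow_tangent_pos`). Hence a configuration whose `(1+t)^k`-energy (`k ≥ 2`) does
not exceed the simplex value `N(N-1)(1 - 1/(N-1))^k` has ALL pairwise inner products equal to `-1/(N-1)`
(`inner_eq_of_ckPow_energy_le`) — it is a regular simplex — and any two such configurations are isometric
(`isometric_of_ckPow_energy_le`, via `GramIsometry`): the regular simplex is the unique ground state of every
`(1+t)^k`, `k ≥ 2`, among `N ≤ n + 1` points (where the value is attained, `Config.Simplex.exists_config`).

## References
* H. Cohn, A. Kumar, J. Amer. Math. Soc. 20 (2007) 99–148, Table 1 and §1. [`CohnKumar2006`]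
-/

noncomputable section

namespace Summit.Ventures.PackingBounds.Config

open Finset

/-- For unit vectors, `0 ≤ 1 + ⟪x, y⟫`. [folklore] -/
private theorem one_add_inner_nonneg' {n : ℕ} {x y : EuclideanSpace ℝ (Fin n)} (hx : ‖x‖ = 1)
    (hy : ‖y‖ = 1) : 0 ≤ 1 + inner ℝ x y := by
  have h := abs_real_inner_le_norm x y
  rw [hx, hy, mul_one] at h
  linarith [(abs_le.1 h).1]

/-- Tangent-line inequality for `u ↦ u^{m+2}` on `[0, ∞)`: `u^{m+2} ≥ u₀^{m+2} + (m+2) u₀^{m+1} (u - u₀)`. [folklore] -/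
theorem pow_tangent_nonneg (m : ℕ) {u u₀ : ℝ} (hu : 0 ≤ u) (hu₀ : 0 ≤ u₀) :
    0 ≤ u ^ (m + 2) - u₀ ^ (m + 2) - (m + 2 : ℝ) * u₀ ^ (m + 1) * (u - u₀) := by
  induction m with
  | zero => norm_num; nlinarith [sq_nonneg (u - u₀)]
  | succ m ih =>
    have key : u ^ (m + 1 + 2) - u₀ ^ (m + 1 + 2) - ((m + 1 : ℕ) + 2 : ℝ) * u₀ ^ (m + 1 + 1) * (u - u₀) =
        u * (u ^ (m + 2) - u₀ ^ (m + 2) - (m + 2 : ℝ) * u₀ ^ (m + 1) * (u - u₀)) +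
          (m + 2 : ℝ) * u₀ ^ (m + 1) * (u - u₀) ^ 2 := by
      push_cast; ring
    rw [key]
    have h2 : 0 ≤ (m + 2 : ℝ) * u₀ ^ (m + 1) * (u - u₀) ^ 2 := by positivity
    nlinarith [mul_nonneg hu ih]

/-- Strict tangent-line inequality for `u ↦ u^{m+2}` on `[0, ∞)` off the touching point. [folklore] -/
theorem pow_tangent_pos (m : ℕ) {u u₀ : ℝ} (hu : 0 ≤ u) (hu₀ : 0 ≤ u₀) (hne : u ≠ u₀) :
    0 < u ^ (m + 2) - u₀ ^ (m + 2) - (m + 2 : ℝ) * u₀ ^ (m + 1) * (u - u₀) := by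
  induction m with
  | zero =>
    have h : 0 < (u - u₀) ^ 2 := by
      have : u - u₀ ≠ 0 := sub_ne_zero.mpr hne
      positivity
    norm_num
    nlinarith
  | succ m ih =>
    have key : u ^ (m + 1 + 2) - u₀ ^ (m + 1 + 2) - ((m + 1 : ℕ) + 2 : ℝ) * u₀ ^ (m + 1 + 1) * (u - u₀) =
        u * (u ^ (m + 2) - u₀ ^ (m + 2) - (m + 2 : ℝ) * u₀ ^ (m + 1) * (u - u₀)) +
          (m + 2 : ℝ) * u₀ ^ (m + 1) * (u - u₀) ^ 2 := by
      push_cast; ring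
    rw [key]
    rcases eq_or_lt_of_le hu with h0 | hpos
    · -- `u = 0`, so `u₀ > 0` and the second term is positive
      subst h0
      have hu₀' : 0 < u₀ := lt_of_le_of_ne hu₀ (fun h => hne h)
      have : 0 < (m + 2 : ℝ) * u₀ ^ (m + 1) * (0 - u₀) ^ 2 := by
        have : (0 - u₀) ^ 2 = u₀ ^ 2 := by ring
        rw [this]; positivity
      simpa using this
    · have h2 : 0 ≤ (m + 2 : ℝ) * u₀ ^ (m + 1) * (u - u₀) ^ 2 := by positivity
      nlinarith [mul_pos hpos ih]

/-- For unit vectors, `Σ_{x ≠ y} ⟪x,y⟫ = ‖Σ x‖² - |C|`. [folklore] -/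
theorem sum_inner_erase_eq {n : ℕ} (C : Finset (EuclideanSpace ℝ (Fin n))) (h1 : ∀ x ∈ C, ‖x‖ = 1) :
    ∑ x ∈ C, ∑ y ∈ C.erase x, inner ℝ x y = ‖∑ x ∈ C, x‖ ^ 2 - C.card := by
  classical
  have hnorm : ‖∑ x ∈ C, x‖ ^ 2 = ∑ x ∈ C, ∑ y ∈ C, inner ℝ x y := by
    rw [← real_inner_self_eq_norm_sq, sum_inner]
    exact Finset.sum_congr rfl fun x _ => inner_sum _ _ _
  have hdiag : ∀ x ∈ C, ∑ y ∈ C.erase x, inner ℝ x y = ∑ y ∈ C, inner ℝ x y - 1 := by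
    intro x hx
    rw [← Finset.sum_erase_add _ _ hx, real_inner_self_eq_norm_sq, h1 x hx]; ring
  rw [Finset.sum_congr rfl hdiag, Finset.sum_sub_distrib, hnorm]
  simp

/-- **Tangent-line lower bound for the `(1+t)^{m+2}`-energy** of `N ≥ 2` unit vectors: with `u₀ = 1 - 1/(N-1)`,
`Σ_{x ≠ y} (1+⟪x,y⟫)^{m+2} ≥ N(N-1) u₀^{m+2} + (m+2) u₀^{m+1} ‖Σ x‖²`. [folklore] -/
theorem ckPow_energy_ge_tangent {n : ℕ} (m : ℕ) (C : Finset (EuclideanSpace ℝ (Fin n)))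
    (h1 : ∀ x ∈ C, ‖x‖ = 1) (h2 : 2 ≤ C.card) :
    (C.card : ℝ) * ((C.card : ℝ) - 1) * (1 - 1 / ((C.card : ℝ) - 1)) ^ (m + 2) +
        (m + 2 : ℝ) * (1 - 1 / ((C.card : ℝ) - 1)) ^ (m + 1) * ‖∑ x ∈ C, x‖ ^ 2 ≤
      ∑ x ∈ C, ∑ y ∈ C.erase x, (1 + inner ℝ x y) ^ (m + 2) := by
  classical
  set N : ℝ := (C.card : ℝ) with hNdef
  have hN2 : (2 : ℝ) ≤ N := by rw [hNdef]; exact_mod_cast h2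
  set u₀ : ℝ := 1 - 1 / (N - 1) with hu₀def
  have hu₀ : 0 ≤ u₀ := by
    rw [hu₀def, sub_nonneg, div_le_one (by linarith)]; linarith
  -- termwise tangent inequality
  have hterm : ∀ x ∈ C, ∀ y ∈ C.erase x,
      u₀ ^ (m + 2) + (m + 2 : ℝ) * u₀ ^ (m + 1) * ((1 + inner ℝ x y) - u₀) ≤ (1 + inner ℝ x y) ^ (m + 2) := by
    intro x hx y hy
    have hb := one_add_inner_nonneg' (h1 x hx) (h1 y (Finset.mem_of_mem_erase hy))
    linarith [pow_tangent_nonneg m hb hu₀]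
  have hsum := Finset.sum_le_sum fun x hx => Finset.sum_le_sum fun y hy => hterm x hx y hy
  refine le_trans (le_of_eq ?_) hsum
  -- evaluate the left-hand side
  have hcount : ∀ c : ℝ, ∑ x ∈ C, ∑ y ∈ C.erase x, c = N * (N - 1) * c := by
    intro c
    rw [Finset.sum_congr rfl fun x hx => by rw [Finset.sum_const, Finset.card_erase_of_mem hx]]
    rw [Finset.sum_const, nsmul_eq_mul, nsmul_eq_mul, hNdef, Nat.cast_sub (by omega)]
    push_cast; ring
  have hlin : ∑ x ∈ C, ∑ y ∈ C.erase x,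
      (u₀ ^ (m + 2) + (m + 2 : ℝ) * u₀ ^ (m + 1) * ((1 + inner ℝ x y) - u₀)) =
      N * (N - 1) * (u₀ ^ (m + 2) + (m + 2 : ℝ) * u₀ ^ (m + 1) * (1 - u₀)) +
        (m + 2 : ℝ) * u₀ ^ (m + 1) * ∑ x ∈ C, ∑ y ∈ C.erase x, inner ℝ x y := by
    have hsplit : ∀ x y : EuclideanSpace ℝ (Fin n),
        u₀ ^ (m + 2) + (m + 2 : ℝ) * u₀ ^ (m + 1) * ((1 + inner ℝ x y) - u₀) =
        (u₀ ^ (m + 2) + (m + 2 : ℝ) * u₀ ^ (m + 1) * (1 - u₀)) +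
          (m + 2 : ℝ) * u₀ ^ (m + 1) * inner ℝ x y := fun x y => by ring
    simp_rw [hsplit, Finset.sum_add_distrib, ← Finset.mul_sum]
    simp only [hcount]
    ring
  rw [hlin, sum_inner_erase_eq C h1, ← hNdef]
  have hN1 : N - 1 ≠ 0 := by linarith
  rw [hu₀def]
  field_simp
  ring

/-- **Rigidity of the simplex energy.** If `N ≥ 2` unit vectors of `ℝⁿ` have `(1+t)^{m+2}`-energy at most the
regular-simplex value `N(N-1)(1 - 1/(N-1))^{m+2}`, then all pairwise inner products equal `-1/(N-1)`.
[cite: CohnKumar2006, Table 1] -/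
theorem inner_eq_of_ckPow_energy_le {n : ℕ} (m : ℕ) (C : Finset (EuclideanSpace ℝ (Fin n)))
    (h1 : ∀ x ∈ C, ‖x‖ = 1) (h2 : 2 ≤ C.card)
    (hE : ∑ x ∈ C, ∑ y ∈ C.erase x, (1 + inner ℝ x y) ^ (m + 2) ≤
      (C.card : ℝ) * ((C.card : ℝ) - 1) * (1 - 1 / ((C.card : ℝ) - 1)) ^ (m + 2)) :
    ∀ x ∈ C, ∀ y ∈ C, x ≠ y → inner ℝ x y = -1 / ((C.card : ℝ) - 1) := by
  classical
  set N : ℝ := (C.card : ℝ) with hNdef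
  have hN2 : (2 : ℝ) ≤ N := by rw [hNdef]; exact_mod_cast h2
  set u₀ : ℝ := 1 - 1 / (N - 1) with hu₀def
  have hu₀ : 0 ≤ u₀ := by
    rw [hu₀def, sub_nonneg, div_le_one (by linarith)]; linarith
  -- the defect `Σ f(t_xy)` is `≤ 0`, each term `≥ 0`
  set f : ℝ → ℝ := fun t => (1 + t) ^ (m + 2) - u₀ ^ (m + 2) - (m + 2 : ℝ) * u₀ ^ (m + 1) * ((1 + t) - u₀)
    with hfdef
  have hfnn : ∀ x ∈ C, ∀ y ∈ C.erase x, 0 ≤ f (inner ℝ x y) := fun x hx y hy =>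
    pow_tangent_nonneg m (one_add_inner_nonneg' (h1 x hx) (h1 y (Finset.mem_of_mem_erase hy))) hu₀
  have hcount : ∀ c : ℝ, ∑ x ∈ C, ∑ y ∈ C.erase x, c = N * (N - 1) * c := by
    intro c
    rw [Finset.sum_congr rfl fun x hx => by rw [Finset.sum_const, Finset.card_erase_of_mem hx]]
    rw [Finset.sum_const, nsmul_eq_mul, nsmul_eq_mul, hNdef, Nat.cast_sub (by omega)]
    push_cast; ring
  have hdefect : ∑ x ∈ C, ∑ y ∈ C.erase x, f (inner ℝ x y) =
      ∑ x ∈ C, ∑ y ∈ C.erase x, (1 + inner ℝ x y) ^ (m + 2) -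
        (N * (N - 1) * (u₀ ^ (m + 2) + (m + 2 : ℝ) * u₀ ^ (m + 1) * (1 - u₀)) +
          (m + 2 : ℝ) * u₀ ^ (m + 1) * ∑ x ∈ C, ∑ y ∈ C.erase x, inner ℝ x y) := by
    have hsplit : ∀ x y : EuclideanSpace ℝ (Fin n), f (inner ℝ x y) =
        (1 + inner ℝ x y) ^ (m + 2) - ((u₀ ^ (m + 2) + (m + 2 : ℝ) * u₀ ^ (m + 1) * (1 - u₀)) +
          (m + 2 : ℝ) * u₀ ^ (m + 1) * inner ℝ x y) := fun x y => by rw [hfdef]; ring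
    simp_rw [hsplit, Finset.sum_sub_distrib, Finset.sum_add_distrib, ← Finset.mul_sum]
    simp only [hcount]
    ring
  have hN1 : N - 1 ≠ 0 := by linarith
  have hval : N * (N - 1) * (u₀ ^ (m + 2) + (m + 2 : ℝ) * u₀ ^ (m + 1) * (1 - u₀)) +
      (m + 2 : ℝ) * u₀ ^ (m + 1) * ∑ x ∈ C, ∑ y ∈ C.erase x, inner ℝ x y =
      N * (N - 1) * u₀ ^ (m + 2) + (m + 2 : ℝ) * u₀ ^ (m + 1) * ‖∑ x ∈ C, x‖ ^ 2 := by
    rw [sum_inner_erase_eq C h1, ← hNdef, hu₀def]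
    field_simp
    ring
  have hle0 : ∑ x ∈ C, ∑ y ∈ C.erase x, f (inner ℝ x y) ≤ 0 := by
    rw [hdefect, hval]
    have : 0 ≤ (m + 2 : ℝ) * u₀ ^ (m + 1) * ‖∑ x ∈ C, x‖ ^ 2 := by positivity
    have hE' : ∑ x ∈ C, ∑ y ∈ C.erase x, (1 + inner ℝ x y) ^ (m + 2) ≤ N * (N - 1) * u₀ ^ (m + 2) := by
      rw [hNdef, hu₀def]; exact hE
    linarith
  have hsum0 : ∑ x ∈ C, ∑ y ∈ C.erase x, f (inner ℝ x y) = 0 :=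
    le_antisymm hle0 (Finset.sum_nonneg fun x hx => Finset.sum_nonneg fun y hy => hfnn x hx y hy)
  intro x hx y hy hxy
  have hyx : y ∈ C.erase x := Finset.mem_erase.mpr ⟨hxy.symm, hy⟩
  have hx0 := (Finset.sum_eq_zero_iff_of_nonneg fun x hx =>
    Finset.sum_nonneg fun y hy => hfnn x hx y hy).mp hsum0 x hx
  have hxy0 := (Finset.sum_eq_zero_iff_of_nonneg fun y hy => hfnn x hx y hy).mp hx0 y hyx
  by_contra hne
  have hne' : 1 + inner ℝ x y ≠ u₀ := by
    intro h; apply hne; rw [hu₀def] at h; linear_combination h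
  have hpos := pow_tangent_pos m (one_add_inner_nonneg' (h1 x hx) (h1 y hy)) hu₀ hne'
  rw [hfdef] at hxy0
  exact absurd hxy0 (ne_of_gt hpos)

/-- **Uniqueness of the simplex ground states**: two configurations of `N ≥ 2` unit vectors of `ℝⁿ` whose
`(1+t)^{m+2}`-energies do not exceed the regular-simplex value are isometric (both are regular simplices).
[cite: CohnKumar2006, Table 1] -/
theorem isometric_of_ckPow_energy_le {n : ℕ} (m : ℕ) (C C' : Finset (EuclideanSpace ℝ (Fin n)))
    (h1 : ∀ x ∈ C, ‖x‖ = 1) (h1' : ∀ x ∈ C', ‖x‖ = 1) (h2 : 2 ≤ C.card) (hcard : C.card = C'.card)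
    (hE : ∑ x ∈ C, ∑ y ∈ C.erase x, (1 + inner ℝ x y) ^ (m + 2) ≤
      (C.card : ℝ) * ((C.card : ℝ) - 1) * (1 - 1 / ((C.card : ℝ) - 1)) ^ (m + 2))
    (hE' : ∑ x ∈ C', ∑ y ∈ C'.erase x, (1 + inner ℝ x y) ^ (m + 2) ≤
      (C'.card : ℝ) * ((C'.card : ℝ) - 1) * (1 - 1 / ((C'.card : ℝ) - 1)) ^ (m + 2)) :
    ∃ Ψ : EuclideanSpace ℝ (Fin n) ≃ₗᵢ[ℝ] EuclideanSpace ℝ (Fin n), C' = C.image Ψ := by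
  have hc := inner_eq_of_ckPow_energy_le m C h1 h2 hE
  have hc' := inner_eq_of_ckPow_energy_le m C' h1' (hcard ▸ h2) hE'
  rw [← hcard] at hc'
  exact isometric_of_inner_const C C' _ h1 hc h1' hc' hcard

end Summit.Ventures.PackingBounds.Config

end
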